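import Literature.AlgebraicGeometry.Resolution.Lipman1969IntersectionTheory
import HarnessLib

/-!
# Lipman 1969, Proposition (13.1) a) holds: `(D·E)` is an integer multiple of `h⁰(E)`

Topic: `Literature/AlgebraicGeometry/Resolution`. DISCHARGE of the named fact
`Lipman1969_13_1_a` (`Literature/AlgebraicGeometry/Resolution/Lipman1969IntersectionTheory.lean`):
for `π : X → Spec S` proper, `S` Noetherian local, `X` integral (regularity of `X` is not used), `D` a
Cartier divisor on `X` and `η ∈ excCurvePoints π`, the intersection number
`(D·E_η) = excCurveDegree π D η = Σ_y ord_y(D|E_η) [κ(y) : κ(𝔪)]` is an integer multiple of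
`h⁰(E_η) = h0 π (primeDivisorIdeal η) = length_S Γ(E_η, 𝒪)`.

Proof (Lipman, p. 223, "a) is immediate from (10.3)"; here spelled out): `E = E_η` is integral and
proper over `Spec S`, lying over the closed point, so `E → Spec S` factors as
`E → Spec Γ(E, 𝒪_E) → Spec κ(𝔪) → Spec S`; `L = Γ(E, 𝒪_E)` is a field, finite over `κ(𝔪)`
(Mathlib `isField_of_universallyClosed`, `finite_appTop_of_universallyClosed`), so
`h⁰(E) = length_S L = [L : κ(𝔪)]`, and for every `y ∈ E`, `[κ(y) : κ(𝔪)] = [κ(y) : L]·[L : κ(𝔪)]`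
(tower law, `residueDegree_comp`); hence `(D·E) = (Σ_y ord_y(D|E) [κ(y) : L]) · h⁰(E)`.

## Sources

* J. Lipman, *Rational singularities, with applications to algebraic surfaces and unique
  factorization*, Publ. Math. IHÉS 36 (1969), Proposition (13.1) a) (p. 223), Corollary (10.3) (p. 213).
  [Lipman1969]
-/

noncomputable section

open CategoryTheory AlgebraicGeometry TopologicalSpace IsLocalRing Opposite
open Literature.AlgebraicGeometry.Morphisms Literature.AlgebraicGeometry.Motives

universe u

namespace Literature.AlgebraicGeometry.Resolution

namespace Lipman1969_13_1_a_holds_aux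

/-- For a field `K` and a point `p` of `Spec K`: an identification `K ≃ κ(p)` compatible with
`ΓSpecIso`, `germ` and `residue` (existence only, so that this file stays definition-free). [folklore] -/
private theorem exists_fieldResidueEquiv (K : Type u) [Field K] (p : Spec (.of K)) :
    ∃ e : K ≃+* (Spec (.of K)).residueField p, ∀ c : K, e c = (Spec (.of K)).residue p
      ((Spec (.of K)).presheaf.germ ⊤ p trivial ((Scheme.ΓSpecIso (.of K)).inv c)) := by
  refine ⟨(Ideal.algEquivResidueFieldOfField p.asIdeal).toRingEquiv.trans
    (Scheme.Spec.residueFieldIso (.of K) p).commRingCatIsoToRingEquiv.symm, fun c => ?_⟩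
  have h := Scheme.Spec.algebraMap_residueFieldIso_inv (.of K) p
  have h' := congrArg (fun f : CommRingCat.of K ⟶ (Spec (.of K)).residueField p ↦ f c) h
  change (Scheme.Spec.residueFieldIso (.of K) p).inv (algebraMap K p.asIdeal.ResidueField c) = _
  exact h'

/-- The residue degree of `Spec L → Spec K` (fields) at any point is `[L : K]`. [folklore] -/
private theorem residueDegree_specMap_eq_finrank {K L : Type u} [Field K] [CommRing L] (hL : IsField L)
    (ψ : K →+* L) (p : Spec (.of L)) :
    (Spec.map (CommRingCat.ofHom ψ)).residueDegree p =
      (letI := ψ.toAlgebra; Module.finrank K L) := by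
  letI : Field L := hL.toField
  letI := ψ.toAlgebra
  set f := Spec.map (CommRingCat.ofHom ψ) with hf
  letI := (f.residueFieldMap p).hom.toAlgebra
  obtain ⟨eK, heK⟩ := exists_fieldResidueEquiv K (f p)
  obtain ⟨eL, heL⟩ := exists_fieldResidueEquiv L p
  symm
  unfold Scheme.Hom.residueDegree
  refine Algebra.finrank_eq_of_equiv_equiv eK eL ?_
  ext c
  change (f.residueFieldMap p).hom (eK c) = eL (ψ c)
  have key : f.appTop ((Scheme.ΓSpecIso (.of K)).inv c) = (Scheme.ΓSpecIso (.of L)).inv (ψ c) := by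
    rw [hf, ← CommRingCat.comp_apply, ← Scheme.ΓSpecIso_inv_naturality, CommRingCat.comp_apply]
    rfl
  rw [heK, heL, ← CommRingCat.comp_apply, Scheme.residue_residueFieldMap, CommRingCat.comp_apply]
  erw [Scheme.Hom.germ_stalkMap_apply, key]
  rfl

/-- `length_S M = dim_{κ(S)} M` for an `S`-module structure factoring through `κ(S)`. [folklore] -/
private theorem toNat_length_eq_finrank {S : Type u} [CommRing S] [IsLocalRing S] {M : Type u}
    [AddCommGroup M] [Module S M] [Module (ResidueField S) M] [IsScalarTower S (ResidueField S) M]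
    [Module.Finite (ResidueField S) M] :
    (Module.length S M).toNat = Module.finrank (ResidueField S) M := by
  rw [Module.length_eq_of_surjective (S := S) (R := ResidueField S) residue_surjective,
    Module.length_eq_finrank]
  rfl

end Lipman1969_13_1_a_holds_aux

open Lipman1969_13_1_a_holds_aux in
/-- **Lipman 1969, Proposition (13.1) a)** — DISCHARGE of the named fact `Lipman1969_13_1_a`: on a
proper `π : X → Spec S` (`S` Noetherian local, `X` integral; the regularity hypothesis is not used),
for every Cartier divisor `D` and every `η ∈ excCurvePoints π`, `excCurveDegree π D η` is an integer
multiple of `(h0 π (primeDivisorIdeal η)).toNat = h⁰(E_η) = [Γ(E_η, 𝒪) : κ(𝔪)]`, namely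
`(Σ_y ord_y(D|E_η) [κ(y) : Γ(E_η, 𝒪)]) · h⁰(E_η)`. [cite: Lipman1969, Proposition (13.1) a) (p. 223)] -/
theorem Lipman1969_13_1_a_holds : Lipman1969_13_1_a.{u} := by
  intro S _ _ _ X _ _ π hπ _ D η hη
  haveI := hπ
  -- the integral curve `E = E_η` and its ring of global functions, as an `S`-algebra
  let E := ClosedSubvariety.ofPoint X η
  let Lk : Type u := Sections (E.ι ≫ π) ⊤
  let φ₀ : S →+* Lk := algebraMap S Lk
  have hkill : ∀ a ∈ maximalIdeal S, φ₀ a = 0 := fun a ha => by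
    show algebraMap S (Sections (E.ι ≫ π) ⊤) a = 0
    rw [Sections.algebraMap_apply]
    have h0 : Morphisms.algebraMapΓ (E.ι ≫ π) a = 0 :=
      appTop_ΓSpecIso_inv_eq_zero_of_mem_maximalIdeal π hη.1 ha
    rw [h0, map_zero]
    rfl
  let ψ : ResidueField S →+* Lk := Ideal.Quotient.lift (maximalIdeal S) φ₀ hkill
  letI : Algebra (ResidueField S) Lk := ψ.toAlgebra
  haveI : IsScalarTower S (ResidueField S) Lk :=
    IsScalarTower.of_algebraMap_eq' (RingHom.ext fun a => rfl)
  -- the factorisation `E → Spec Γ(E, 𝒪_E) → Spec κ(𝔪)` of `E → X → Spec S`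
  let t : E.carrier ⟶ Spec Γ(E.carrier, ⊤) := E.carrier.toSpecΓ
  let ψc : CommRingCat.of (ResidueField S) ⟶ Γ(E.carrier, ⊤) := CommRingCat.ofHom ψ
  let u : Spec Γ(E.carrier, ⊤) ⟶ Spec (.of (ResidueField S)) := Spec.map ψc
  have hψ : CommRingCat.ofHom (residue S) ≫ ψc =
      (Scheme.ΓSpecIso (.of S)).inv ≫ (E.ι ≫ π).appTop := by
    ext a
    change E.carrier.presheaf.map (homOfLE (le_top : (⊤ : E.carrier.Opens) ≤ ⊤)).op
      ((E.ι ≫ π).appTop ((Scheme.ΓSpecIso (.of S)).inv a)) = (E.ι ≫ π).appTop ((Scheme.ΓSpecIso (.of S)).inv a)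
    simp
  have hq : (t ≫ u) ≫ Spec.map (CommRingCat.ofHom (residue S)) = E.ι ≫ π := by
    rw [Category.assoc, ← Spec.map_comp, hψ, Spec.map_comp, ← Category.assoc,
      ← Scheme.toSpecΓ_naturality, Category.assoc, toSpecΓ_SpecMap_ΓSpecIso_inv, Category.comp_id]
  haveI : IsProper (t ≫ u) := isProper_of_fac_specResidueField π hq
  -- `Γ(E, 𝒪_E)` is a field, finite over `κ(𝔪)`
  have hL : IsField Lk := isField_of_universallyClosed (ResidueField S) (t ≫ u)
  have hfin : (t ≫ u).appTop.hom.Finite := finite_appTop_of_universallyClosed (ResidueField S) (t ≫ u)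
  have hψq : ψc = (Scheme.ΓSpecIso (.of (ResidueField S))).inv ≫ (t ≫ u).appTop := by
    rw [show (t ≫ u).appTop = u.appTop ≫ t.appTop from rfl, Scheme.toSpecΓ_appTop, ← Category.assoc,
      ← Scheme.ΓSpecIso_inv_naturality, Category.assoc, Iso.inv_hom_id, Category.comp_id]
  haveI : Module.Finite (ResidueField S) Lk := by
    have h1 : ψ = ((Scheme.ΓSpecIso (.of (ResidueField S))).inv ≫ (t ≫ u).appTop).hom :=
      congrArg CommRingCat.Hom.hom hψq
    rw [CommRingCat.hom_comp] at h1
    have h2 : ψ.Finite := by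
      rw [h1]
      exact hfin.comp (RingHom.Finite.of_surjective _ fun y =>
        ⟨(Scheme.ΓSpecIso (.of (ResidueField S))).hom y, by simp⟩)
    exact h2
  -- `h⁰(E) = [Γ(E, 𝒪_E) : κ(𝔪)]`
  have h0eq : (h0 π (primeDivisorIdeal η)).toNat = Module.finrank (ResidueField S) Lk := by
    show (Module.length S Lk).toNat = _
    exact toNat_length_eq_finrank
  -- residue degrees along `E → Spec S` factor through `Spec Γ(E, 𝒪_E)`
  have hu : ∀ p, u.residueDegree p = Module.finrank (ResidueField S) Lk := fun p =>
    residueDegree_specMap_eq_finrank hL ψ p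
  have hrd : ∀ y : E.carrier, (E.ι ≫ π).residueDegree y =
      t.residueDegree y * Module.finrank (ResidueField S) Lk := fun y => by
    rw [residueDegree_ι_comp_eq_of_fac π hq y, residueDegree_comp, hu]
  refine ⟨∑ᶠ y : E.carrier, (D.pullbackRep E.ι).ordAt y * (t.residueDegree y : ℤ), ?_⟩
  show (∑ᶠ y : E.carrier, (D.pullbackRep E.ι).ordAt y * (((E.ι ≫ π).residueDegree y : ℕ) : ℤ)) = _
  rw [h0eq, finsum_mul]
  refine finsum_congr fun y => ?_
  rw [hrd y]
  push_cast
  ring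

end Literature.AlgebraicGeometry.Resolution
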